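import Literature.MathematicalPhysics.QuantumLattice.DWaveSource
import Literature.MathematicalPhysics.QuantumLattice.DWaveSourceProofs
import Literature.MathematicalPhysics.QuantumLattice.PairCorrelationsProofs
import Literature.MathematicalPhysics.QuantumLattice.HubbardModelParticleHoleProofs
import Literature.MathematicalPhysics.QuantumLattice.HubbardRingPerronFrobeniusProofs
import Literature.MathematicalPhysics.QuantumLattice.PairChirality
import Literature.Barriers.HubbardSuperconductivity.PureModelStripeCompetitionProofs
import HarnessLib

/-!
# WeakCouplingBCS / crux `WcbcsSsbToTorusLRO` (stmt-HubbardSuperconductivity-2009), line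
`quenched-corner-by-square-completion` — glue stub `stub_transferOfSharpConverse`

Notation (fermionic torus `(ℤ/Lℤ)²`, fixed `U, δ, μ`): `P = pairField dWaveFormFactor L`,
`H = hubbardTorus 2 L 1 U`, `K = hubbardTorusWith 2 L 1 U μ = H - μN̂`, `N_L = 2⌊(1-δ)L²/2⌋`,
`S = szSector N_L 0`, `Q^can_t = H - (t/L²)P†P`, `Q^GC_t = K - (t/L²)P†P`,
`E^can_t = minEnergyOn Q^can_t S`, `E^GC_t = groundEnergy Q^GC_t`, `lro φ = Re⟨φ, P†P φ⟩/L⁴`,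
`m = dWaveOrderParameter U μ`, `gap₀ = E^can_0 - μN_L - E^GC_0`,
`gain_can(t) = E^can_0 - E^can_t`, `gain_GC(t) = E^GC_0 - E^GC_t`.

`stub_transferOfSharpConverse`: at fixed `(U, δ, μ)` with `δ ≥ -1`, source-free canonical/GC
equivalence (CGE: `gap₀ ≤ εL²` eventually along even `L`), sharpness of the grand-canonical quenched
corner (GCSharp: `gain_GC(t) ≤ t(m² + ε)L²` for small seeds, eventually in `L`) and the `ε`-sharp
Koma–Tasaki converse (EveryGSSharp: every normalised source-free `S`-sector ground state has
`lro ≥ m² - ε` eventually along even `L`) imply the three open stubs of the line: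
(M2) the gain deficit `gain_GC(t) - gain_can(t) ≤ εtL²`, (H1) pair-order rigidity of the source-free
sector ground states, (H2) every quenched sector ground state is `η`-close in `lro` to some
source-free one. The guard `-1 ≤ δ` makes `N_L/2 ≤ L²`, i.e. the sector `S` non-empty on every side
(`natFloor_filling_le_sq`); for `δ < -1` the sector is empty for large `L`, `E^can_t` is the junk
value `sInf ∅ = 0`, and (M2) would assert `gain_GC(t) = o(tL²)`, which does not follow from the
hypotheses (it fails wherever the GC corner has slope `m² > 0`).

Proof = finite-`L` variational chords + `ε`-bookkeeping (no thermodynamic limit):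
* `quenched_chord`: for a normalised `S`-sector ground state `φ` of `Q^can_s`,
  `(s' - s) L² lro φ ≤ E^can_s - E^can_{s'}` (`φ` is a trial state for `Q^can_{s'}`; the sector
  variational principle is the tree's `sector_groundState`, `Q^can` being Hermitian and block
  diagonal in `(N↑, N↓)` since `P` has grade `(-1,-1)`); `s = 0` gives `tL² lro ψ₀ ≤ gain_can(t)`
  for source-free ground states `ψ₀`;
* `gc_groundEnergy_le_can`: `E^GC_s ≤ E^can_s - μN_L` (a normalised sector ground state of
  `Q^can_s`, which exists by `sector_groundState`, is a trial state for `Q^GC_s = Q^can_s - μN̂`);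
  hence `gain_can(s) ≤ gap₀ + gain_GC(s)`;
* (M2): `gain_can(t) ≥ tL² lro ψ₀ ≥ t(m² - ε/2)L²` and GCSharp; (H1): `lro ψ' ≤ gain_can(t)/(tL²)
  ≤ (gap₀ + gain_GC(t))/(tL²) ≤ m² + ε/4` at a fixed small seed `t`, and `lro ψ ≥ m² - ε/8`;
  (H2): `tL² lro ψ₁ ≤ E^can_t - E^can_{2t} ≤ gap₀ + gain_GC(2t) - tL² lro ψ₀ ≤ tL²(m² + 4η/5)` and
  `lro ψ₀ ≥ m² - η/5`.

Sources: T. Koma, H. Tasaki, J. Stat. Phys. 76 (1994) 745, §1 (variational chords of quenched /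
sourced ground energies) and p. 11 (`μ₁ ≥ μ₂`); H. Tasaki, *Physics and Mathematics of Quantum
Many-Body Systems* (2020) §2.1–2.2 (variational principle, sectors); E. H. Lieb, PRL 62 (1989) 1201
(the `(N↑, N↓)` block structure). No definition is introduced; helper lemmas are private; two of
them are adapted from `Cruxes/WcbcsSsbToTorusLRO/Disproof.lean` (re-proved inline, not imported).
-/

noncomputable section

-- the problem namespace `HubbardSuperconductivity.HubbardSuperconductivity` repeats a component by design
set_option linter.dupNamespace false

namespace Summit.HubbardSuperconductivity.HubbardSuperconductivity.Theorems.WcbcsSsbToTorusLRO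

open Literature.MathematicalPhysics.QuantumLattice Literature.Barriers.HubbardSuperconductivity
open Filter Set Matrix
open scoped Matrix ComplexOrder

/-! ### Finite-`L` lemmas: the quenched canonical model `Q^can_t = H - (t/L²)P†P` in a sector -/

section FiniteL

variable (L : ℕ) [NeZero L]

/-- `Q^can_t = H - (t/L²)P†P` is block diagonal in the sectors `(N↑, N↓)`: `H` is
(`LiebThm1.preservesSectors_hamiltonian`) and `P†P` has grade `(0,0)` because `P` has grade
`(-1,-1)` (`PairChirality.shifts_localPair`).
-- adapted from Cruxes/WcbcsSsbToTorusLRO/Disproof.lean `preservesSectors_quenchedCan` [folklore] -/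
private theorem preservesSectors_quenchedCan (U t : ℝ) :
    PreservesSectors (hubbardTorus 2 L 1 U - ((t / (L : ℝ) ^ 2 : ℝ) : ℂ) •
      ((pairField dWaveFormFactor L)ᴴ * pairField dWaveFormFactor L)) := by
  have hS : PairChirality.Shifts (-1) (-1) (pairField dWaveFormFactor L) :=
    PairChirality.Shifts.sum fun x _ => PairChirality.shifts_localPair L dWaveFormFactor x
  have hP := (hS.conjTranspose).mul hS
  norm_num at hP
  have hPP : PreservesSectors ((pairField dWaveFormFactor L)ᴴ * pairField dWaveFormFactor L) :=
    hP.preservesSectors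
  intro s s' hst
  rw [hubbardTorus, Matrix.sub_apply, Matrix.smul_apply, smul_eq_mul] at hst
  by_cases h1 : hamiltonian (fermionTorusGraph 2 L) 1 U s s' = 0
  · rw [h1, zero_sub, neg_ne_zero] at hst
    exact hPP s s' (right_ne_zero_of_mul hst)
  · exact LiebThm1.preservesSectors_hamiltonian (fermionTorusGraph 2 L) 1 U s s' h1

/-- `Q^can_t` is Hermitian (`H` is, `P†P` is, the coupling is real).
-- adapted from Cruxes/WcbcsSsbToTorusLRO/Disproof.lean `isHermitian_quenchedCan` [folklore] -/
private theorem isHermitian_quenchedCan (U t : ℝ) :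
    (hubbardTorus 2 L 1 U - ((t / (L : ℝ) ^ 2 : ℝ) : ℂ) •
      ((pairField dWaveFormFactor L)ᴴ * pairField dWaveFormFactor L)).IsHermitian := by
  refine (LiebThm1.hamiltonian_isHermitian (fermionTorusGraph 2 L) 1 U).sub (Matrix.IsHermitian.smul ?_ ?_)
  · exact Matrix.isHermitian_conjTranspose_mul_self _
  · rw [isSelfAdjoint_iff, Complex.star_def, Complex.conj_ofReal]

/-- **Sector ground states of `Q^can_t` exist, and the sector variational principle holds**: if the
sector `(2n, S^z = 0)` is non-zero, `Q^can_t` has a normalised ground state in it, and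
`E^can_t ≤ Re⟨v, Q^can_t v⟩` for every unit vector `v` of the sector (tree `sector_groundState`
applied to the coordinate subspace `szSector (2n) 0`, invariant by `preservesSectors_quenchedCan`).
Tasaki (2020) §2.2. [folklore] -/
private theorem quenchedCan_sector (U t : ℝ) (n : ℕ)
    (hne : ∃ φ : Fock (Orb (FermionTorus 2 L)), φ ∈ szSector (2 * n) 0 ∧ φ ≠ 0) :
    (∃ ψ : Fock (Orb (FermionTorus 2 L)), star ψ ⬝ᵥ ψ = 1 ∧
        IsGroundStateInSector (hubbardTorus 2 L 1 U - ((t / (L : ℝ) ^ 2 : ℝ) : ℂ) •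
          ((pairField dWaveFormFactor L)ᴴ * pairField dWaveFormFactor L)) (2 * n) 0 ψ) ∧
      ∀ v ∈ szSector (2 * n) 0, star v ⬝ᵥ v = 1 →
        (hubbardTorus 2 L 1 U - ((t / (L : ℝ) ^ 2 : ℝ) : ℂ) •
            ((pairField dWaveFormFactor L)ᴴ * pairField dWaveFormFactor L)).minEnergyOn
              (szSector (2 * n) 0) ≤
          (star v ⬝ᵥ (hubbardTorus 2 L 1 U - ((t / (L : ℝ) ^ 2 : ℝ) : ℂ) •
            ((pairField dWaveFormFactor L)ᴴ * pairField dWaveFormFactor L)) *ᵥ v).re := by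
  classical
  set Q := hubbardTorus 2 L 1 U - ((t / (L : ℝ) ^ 2 : ℝ) : ℂ) •
    ((pairField dWaveFormFactor L)ᴴ * pairField dWaveFormFactor L) with hQ_def
  obtain ⟨φ, hφ, hφ0⟩ := hne
  have hφ' : IsInSector n n φ := (mem_szSector_two_mul_zero_iff n φ).1 hφ
  have hp : ∃ s : Finset (Orb (FermionTorus 2 L)), (upPart s).card = n ∧ (downPart s).card = n := by
    by_contra h
    push Not at h
    exact hφ0 (funext fun s => hφ' s (fun hs => h s hs.1 hs.2))
  have hinv : ∀ s s' : Finset (Orb (FermionTorus 2 L)), ¬((upPart s).card = n ∧ (downPart s).card = n) →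
      ((upPart s').card = n ∧ (downPart s').card = n) → Q s s' = 0 := by
    intro s s' hs hs'
    by_contra h
    have := preservesSectors_quenchedCan L U t s s' h
    exact hs ⟨this.1.trans hs'.1, this.2.trans hs'.2⟩
  obtain ⟨⟨v, hv, hv0, hQv⟩, hb⟩ := sector_groundState Q (isHermitian_quenchedCan L U t)
    (fun s => (upPart s).card = n ∧ (downPart s).card = n) hp hinv (szSector (2 * n) 0)
    (fun v => mem_szSector_two_mul_zero_iff n v)
  obtain ⟨c, hc0, hc1⟩ := exists_smul_unit hv0
  exact ⟨⟨c • v, hc1, isGroundStateInSector_smul ⟨hv, hv0, hQv⟩ hc0⟩, hb⟩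

/-- **The quenched chord.** For a normalised `(2n, S^z=0)`-sector ground state `φ` of `Q^can_s`
and any second seed `s'`: `(s' - s) L² · lro φ ≤ E^can_s - E^can_{s'}` — `φ` is a trial state for
`Q^can_{s'} = Q^can_s - ((s'-s)/L²)P†P` in its sector. Koma–Tasaki, J. Stat. Phys. 76 (1994) 745,
§1. [cite: KomaTasaki1994, §1] -/
private theorem quenched_chord (U s s' : ℝ) (n : ℕ) (φ : Fock (Orb (FermionTorus 2 L)))
    (hφ : IsGroundStateInSector (hubbardTorus 2 L 1 U - ((s / (L : ℝ) ^ 2 : ℝ) : ℂ) •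
      ((pairField dWaveFormFactor L)ᴴ * pairField dWaveFormFactor L)) (2 * n) 0 φ)
    (h1 : star φ ⬝ᵥ φ = 1) :
    (s' - s) * (L : ℝ) ^ 2 *
        ((expect ((pairField dWaveFormFactor L)ᴴ * pairField dWaveFormFactor L) φ).re / (L : ℝ) ^ 4) ≤
      (hubbardTorus 2 L 1 U - ((s / (L : ℝ) ^ 2 : ℝ) : ℂ) •
            ((pairField dWaveFormFactor L)ᴴ * pairField dWaveFormFactor L)).minEnergyOn (szSector (2 * n) 0) -
        (hubbardTorus 2 L 1 U - ((s' / (L : ℝ) ^ 2 : ℝ) : ℂ) •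
            ((pairField dWaveFormFactor L)ᴴ * pairField dWaveFormFactor L)).minEnergyOn (szSector (2 * n) 0) := by
  set M := (pairField dWaveFormFactor L)ᴴ * pairField dWaveFormFactor L with hM_def
  -- the variational principle for `Q^can_{s'}` at `φ`
  have hvar := (quenchedCan_sector L U s' n ⟨φ, hφ.1, hφ.2.1⟩).2 φ hφ.1 h1
  -- `Q^can_{s'} = Q^can_s - ((s' - s)/L²) P†P`
  have e : hubbardTorus 2 L 1 U - ((s' / (L : ℝ) ^ 2 : ℝ) : ℂ) • M =
      (hubbardTorus 2 L 1 U - ((s / (L : ℝ) ^ 2 : ℝ) : ℂ) • M) - (((s' - s) / (L : ℝ) ^ 2 : ℝ) : ℂ) • M := by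
    rw [sub_sub, ← add_smul, ← Complex.ofReal_add,
      show s / (L : ℝ) ^ 2 + (s' - s) / (L : ℝ) ^ 2 = s' / (L : ℝ) ^ 2 by ring]
  have hre : (star φ ⬝ᵥ (hubbardTorus 2 L 1 U - ((s' / (L : ℝ) ^ 2 : ℝ) : ℂ) • M) *ᵥ φ).re =
      (hubbardTorus 2 L 1 U - ((s / (L : ℝ) ^ 2 : ℝ) : ℂ) • M).minEnergyOn (szSector (2 * n) 0) -
        (s' - s) / (L : ℝ) ^ 2 * (expect M φ).re := by
    rw [e, Matrix.sub_mulVec, Matrix.smul_mulVec, hφ.2.2, dotProduct_sub, dotProduct_smul, dotProduct_smul, h1,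
      smul_eq_mul, smul_eq_mul, mul_one, Complex.sub_re, Complex.ofReal_re, Complex.re_ofReal_mul, expect]
  have hL : (0 : ℝ) < (L : ℝ) := Nat.cast_pos.2 (Nat.pos_of_ne_zero (NeZero.ne L))
  have hconv : (s' - s) * (L : ℝ) ^ 2 * ((expect M φ).re / (L : ℝ) ^ 4) = (s' - s) / (L : ℝ) ^ 2 * (expect M φ).re := by
    field_simp
  linarith [hvar, hre, hconv]

/-- **The canonical chord at the source-free ground states**: for a normalised
`(2n, S^z=0)`-sector ground state `ψ₀` of `H`, `tL² · lro ψ₀ ≤ gain_can(t) = E^can_0 - E^can_t`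
(`quenched_chord` at `s = 0`). Koma–Tasaki (1994) §1. [cite: KomaTasaki1994, §1] -/
private theorem expect_le_can_gain (U t : ℝ) (n : ℕ) (ψ₀ : Fock (Orb (FermionTorus 2 L)))
    (hψ₀ : IsGroundStateInSector (hubbardTorus 2 L 1 U) (2 * n) 0 ψ₀) (h1 : star ψ₀ ⬝ᵥ ψ₀ = 1) :
    t * (L : ℝ) ^ 2 *
        ((expect ((pairField dWaveFormFactor L)ᴴ * pairField dWaveFormFactor L) ψ₀).re / (L : ℝ) ^ 4) ≤
      (hubbardTorus 2 L 1 U).minEnergyOn (szSector (2 * n) 0) -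
        (hubbardTorus 2 L 1 U - ((t / (L : ℝ) ^ 2 : ℝ) : ℂ) •
            ((pairField dWaveFormFactor L)ᴴ * pairField dWaveFormFactor L)).minEnergyOn (szSector (2 * n) 0) := by
  have e0 : hubbardTorus 2 L 1 U - (((0 : ℝ) / (L : ℝ) ^ 2 : ℝ) : ℂ) •
      ((pairField dWaveFormFactor L)ᴴ * pairField dWaveFormFactor L) = hubbardTorus 2 L 1 U := by
    rw [zero_div, Complex.ofReal_zero, zero_smul, sub_zero]
  have h := quenched_chord L U 0 t n ψ₀ (by rw [e0]; exact hψ₀) h1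
  rw [e0, sub_zero] at h
  exact h

/-- **The grand-canonical quenched energy lies below the canonical one**:
`E^GC_s ≤ E^can_s - μ N` (`N = 2n`, non-zero sector): a normalised sector ground state `ψ₁` of
`Q^can_s` (exists, `quenchedCan_sector`) is a trial state for the Hermitian `Q^GC_s = Q^can_s - μN̂`
(`hubbardTorusWith_eq`), and `N̂ψ₁ = Nψ₁`. Tasaki (2020) §2.1, (2.1.6). [folklore] -/
private theorem gc_groundEnergy_le_can (U μ s : ℝ) (n : ℕ)
    (hne : ∃ φ : Fock (Orb (FermionTorus 2 L)), φ ∈ szSector (2 * n) 0 ∧ φ ≠ 0) :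
    (hubbardTorusWith 2 L 1 U μ - ((s / (L : ℝ) ^ 2 : ℝ) : ℂ) •
        ((pairField dWaveFormFactor L)ᴴ * pairField dWaveFormFactor L)).groundEnergy ≤
      (hubbardTorus 2 L 1 U - ((s / (L : ℝ) ^ 2 : ℝ) : ℂ) •
            ((pairField dWaveFormFactor L)ᴴ * pairField dWaveFormFactor L)).minEnergyOn (szSector (2 * n) 0) -
        μ * ((2 * n : ℕ) : ℝ) := by
  obtain ⟨⟨ψ₁, h1, hψ₁⟩, -⟩ := quenchedCan_sector L U s n hne
  set M := (pairField dWaveFormFactor L)ᴴ * pairField dWaveFormFactor L with hM_def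
  have hQH : (hubbardTorusWith 2 L 1 U μ - ((s / (L : ℝ) ^ 2 : ℝ) : ℂ) • M).IsHermitian := by
    refine (isHermitian_hubbardTorusWith L 1 U μ).sub (Matrix.IsHermitian.smul ?_ ?_)
    · exact Matrix.isHermitian_conjTranspose_mul_self _
    · rw [isSelfAdjoint_iff, Complex.star_def, Complex.conj_ofReal]
  have hK := Matrix.groundEnergy_le_rayleigh_holds hQH ψ₁ h1
  have hN : (totalNumber : Matrix _ _ ℂ) *ᵥ ψ₁ = ((2 * n : ℕ) : ℂ) • ψ₁ :=
    totalNumber_mulVec_of_isNParticle ((mem_szSector_iff (2 * n) 0 ψ₁).1 hψ₁.1).1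
  have e : hubbardTorusWith 2 L 1 U μ - ((s / (L : ℝ) ^ 2 : ℝ) : ℂ) • M =
      (hubbardTorus 2 L 1 U - ((s / (L : ℝ) ^ 2 : ℝ) : ℂ) • M) - (μ : ℂ) • totalNumber := by
    rw [hubbardTorusWith_eq, sub_right_comm]
  have hre : (star ψ₁ ⬝ᵥ (hubbardTorusWith 2 L 1 U μ - ((s / (L : ℝ) ^ 2 : ℝ) : ℂ) • M) *ᵥ ψ₁).re =
      (hubbardTorus 2 L 1 U - ((s / (L : ℝ) ^ 2 : ℝ) : ℂ) • M).minEnergyOn (szSector (2 * n) 0) -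
        μ * ((2 * n : ℕ) : ℝ) := by
    rw [e, Matrix.sub_mulVec, Matrix.smul_mulVec, hN, hψ₁.2.2, dotProduct_sub, dotProduct_smul, dotProduct_smul,
      dotProduct_smul, h1, smul_eq_mul, smul_eq_mul, smul_eq_mul, mul_one, mul_one]
    simp only [Complex.sub_re, Complex.ofReal_re, Complex.re_ofReal_mul, Complex.natCast_re]
  linarith

end FiniteL

/-! ### The glue stub -/

/-- **Glue stub `stub_transferOfSharpConverse`** (line `quenched-corner-by-square-completion` of crux
`WcbcsSsbToTorusLRO`). At fixed `(U, δ, μ)` with `-1 ≤ δ`: source-free canonical/GC equivalence at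
`μ` (CGE), sharpness of the grand-canonical quenched corner (GCSharp) and the `ε`-sharp Koma–Tasaki
converse for every source-free `(N_L, S^z=0)`-sector ground state (EveryGSSharp) imply (M2) the
quenched gain deficit, (H1) pair-order rigidity of the source-free sector ground states and (H2) that
every quenched sector ground state is `η`-close in pair order to some source-free one — the bodies of
the line's three open stubs. Finite-`L` variational chords (`quenched_chord`, `expect_le_can_gain`,
`gc_groundEnergy_le_can`) and `ε`-bookkeeping; see the module docstring. Koma–Tasaki, J. Stat.
Phys. 76 (1994) 745, §1 and p. 11. [cite: KomaTasaki1994, §1] -/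
theorem stub_transferOfSharpConverse : ∀ (U δ μ : ℝ), -1 ≤ δ → (∀ ε : ℝ, 0 < ε → ∃ L₀ : ℕ, ∀ L : ℕ, L₀ ≤ L → Even L → (hubbardTorus 2 L 1 U).minEnergyOn (szSector (2 * ⌊(1 - δ) * (L : ℝ) ^ 2 / 2⌋₊) 0) - μ * ((2 * ⌊(1 - δ) * (L : ℝ) ^ 2 / 2⌋₊ : ℕ) : ℝ) - (hubbardTorusWith 2 L 1 U μ).groundEnergy ≤ ε * (L : ℝ) ^ 2) → (∀ ε : ℝ, 0 < ε → ∃ t₀ : ℝ, 0 < t₀ ∧ ∀ t ∈ Set.Ioo (0:ℝ) t₀, ∃ L₀ : ℕ, ∀ (L : ℕ) [NeZero L], L₀ ≤ L → (hubbardTorusWith 2 L 1 U μ).groundEnergy - (hubbardTorusWith 2 L 1 U μ - ((t / (L : ℝ) ^ 2 : ℝ) : ℂ) • ((pairField dWaveFormFactor L)ᴴ * pairField dWaveFormFactor L)).groundEnergy ≤ t * (dWaveOrderParameter U μ ^ 2 + ε) * (L : ℝ) ^ 2) → (∀ ε : ℝ, 0 < ε → ∃ L₀ : ℕ, ∀ (L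 : ℕ) [NeZero L], L₀ ≤ L → Even L → ∀ ψ : Fock (Orb (FermionTorus 2 L)), IsGroundStateInSector (hubbardTorus 2 L 1 U) (2 * ⌊(1 - δ) * (L : ℝ) ^ 2 / 2⌋₊) 0 ψ → star ψ ⬝ᵥ ψ = 1 → dWaveOrderParameter U μ ^ 2 - ε ≤ (expect ((pairField dWaveFormFactor L)ᴴ * pairField dWaveFormFactor L) ψ).re / (L : ℝ) ^ 4) → (∀ ε : ℝ, 0 < ε → ∃ t₀ : ℝ, 0 < t₀ ∧ ∀ t ∈ Set.Ioo (0:ℝ) t₀, ∃ L₀ : ℕ, ∀ (L : ℕ) [NeZero L], L₀ ≤ L → Even L → ((hubbardTorusWith 2 L 1 U μ).groundEnergy - (hubbardTorusWith 2 L 1 U μ - ((t / (L : ℝ) ^ 2 : ℝ) : ℂ) • ((pairField dWaveFormFactor L)ᴴ * pairField dWaveFormFactor L)).groundEnergy) - ((hubbardTorus 2 L 1 U).minEnergyOn (szSector (2 * ⌊(1 - δ) * (L : ℝ) ^ 2 / 2⌋₊) 0) - (hubbardTorus 2 L 1 U - ((t / (L : ℝ) ^ 2 : ℝ) : ℂ)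 • ((pairField dWaveFormFactor L)ᴴ * pairField dWaveFormFactor L)).minEnergyOn (szSector (2 * ⌊(1 - δ) * (L : ℝ) ^ 2 / 2⌋₊) 0)) ≤ ε * t * (L : ℝ) ^ 2) ∧ (∀ ε : ℝ, 0 < ε → ∃ L₀ : ℕ, ∀ (L : ℕ) [NeZero L], L₀ ≤ L → Even L → ∀ ψ ψ' : Fock (Orb (FermionTorus 2 L)), IsGroundStateInSector (hubbardTorus 2 L 1 U) (2 * ⌊(1 - δ) * (L : ℝ) ^ 2 / 2⌋₊) 0 ψ → star ψ ⬝ᵥ ψ = 1 → IsGroundStateInSector (hubbardTorus 2 L 1 U) (2 * ⌊(1 - δ) * (L : ℝ) ^ 2 / 2⌋₊) 0 ψ' → star ψ' ⬝ᵥ ψ' = 1 → (expect ((pairField dWaveFormFactor L)ᴴ * pairField dWaveFormFactor L) ψ').re / (L : ℝ) ^ 4 - (expect ((pairField dWaveFormFactor L)ᴴ * pairField dWaveFormFactor L) ψ).re / (L : ℝ) ^ 4 ≤ ε) ∧ (∀ η : ℝ, 0 < η → ∃ t₁ : ℝ, 0 < t₁ ∧ ∀ t ∈ Set.Ioo (0:ℝ)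 t₁, ∃ L₀ : ℕ, ∀ (L : ℕ) [NeZero L], L₀ ≤ L → Even L → ∀ ψ₁ : Fock (Orb (FermionTorus 2 L)), IsGroundStateInSector (hubbardTorus 2 L 1 U - ((t / (L : ℝ) ^ 2 : ℝ) : ℂ) • ((pairField dWaveFormFactor L)ᴴ * pairField dWaveFormFactor L)) (2 * ⌊(1 - δ) * (L : ℝ) ^ 2 / 2⌋₊) 0 ψ₁ → star ψ₁ ⬝ᵥ ψ₁ = 1 → ∃ ψ₀ : Fock (Orb (FermionTorus 2 L)), IsGroundStateInSector (hubbardTorus 2 L 1 U) (2 * ⌊(1 - δ) * (L : ℝ) ^ 2 / 2⌋₊) 0 ψ₀ ∧ star ψ₀ ⬝ᵥ ψ₀ = 1 ∧ (expect ((pairField dWaveFormFactor L)ᴴ * pairField dWaveFormFactor L) ψ₁).re / (L : ℝ) ^ 4 - (expect ((pairField dWaveFormFactor L)ᴴ * pairField dWaveFormFactor L) ψ₀).re / (L : ℝ) ^ 4 ≤ η) := by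
  intro U δ μ hδ hCGE hGC hEGS
  have hn : ∀ L : ℕ, ⌊(1 - δ) * (L : ℝ) ^ 2 / 2⌋₊ ≤ L ^ 2 := fun L => natFloor_filling_le_sq hδ L
  refine ⟨?_, ?_, ?_⟩
  · -- (M2) the gain deficit
    intro ε hε
    obtain ⟨t₀, ht₀, hG⟩ := hGC (ε / 2) (by positivity)
    refine ⟨t₀, ht₀, fun t ht => ?_⟩
    obtain ⟨L₁, hL₁⟩ := hG t ht
    obtain ⟨L₂, hL₂⟩ := hEGS (ε / 2) (by positivity)
    refine ⟨max L₁ L₂, fun L _ hL hev => ?_⟩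
    obtain ⟨ψ₀, hψ₀1, hψ₀⟩ := exists_unit_isGroundStateInSector_hubbardTorus U L _ (hn L)
    have h1 := hL₁ L (le_of_max_le_left hL)
    have h2 := hL₂ L (le_of_max_le_right hL) hev ψ₀ hψ₀ hψ₀1
    have h3 := expect_le_can_gain L U t _ ψ₀ hψ₀ hψ₀1
    have ht0 : 0 ≤ t := ht.1.le
    have htL : 0 ≤ t * (L : ℝ) ^ 2 := by positivity
    have h4 := mul_le_mul_of_nonneg_left h2 htL
    linarith
  · -- (H1) pair-order rigidity
    intro ε hε
    obtain ⟨t₀, ht₀, hG⟩ := hGC (ε / 8) (by positivity)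
    have ht : t₀ / 2 ∈ Set.Ioo (0:ℝ) t₀ := ⟨by positivity, by linarith⟩
    obtain ⟨L₁, hL₁⟩ := hG (t₀ / 2) ht
    obtain ⟨L₂, hL₂⟩ := hCGE (ε / 8 * (t₀ / 2)) (by positivity)
    obtain ⟨L₃, hL₃⟩ := hEGS (ε / 8) (by positivity)
    refine ⟨max L₁ (max L₂ L₃), fun L _ hL hev ψ ψ' hψ hψ1 hψ' hψ'1 => ?_⟩
    have hL1 : L₁ ≤ L := le_of_max_le_left hL
    have hL2 : L₂ ≤ L := (le_max_left _ _).trans (le_of_max_le_right hL)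
    have hL3 : L₃ ≤ L := (le_max_right _ _).trans (le_of_max_le_right hL)
    have h1 := hL₁ L hL1
    have h2 := hL₂ L hL2 hev
    have h3 := hL₃ L hL3 hev ψ hψ hψ1
    have h4 := expect_le_can_gain L U (t₀ / 2) _ ψ' hψ' hψ'1
    have h5 := gc_groundEnergy_le_can L U μ (t₀ / 2) _ ⟨ψ, hψ.1, hψ.2.1⟩
    have hLpos : (0 : ℝ) < (L : ℝ) := Nat.cast_pos.2 (Nat.pos_of_ne_zero (NeZero.ne L))
    have htL : 0 < t₀ / 2 * (L : ℝ) ^ 2 := by positivity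
    have hεL : 0 ≤ t₀ / 2 * (L : ℝ) ^ 2 * ε := by positivity
    refine le_of_mul_le_mul_left ?_ htL
    linarith [mul_le_mul_of_nonneg_left h3 htL.le]
  · -- (H2) corner to max
    intro η hη
    obtain ⟨t₀, ht₀, hG⟩ := hGC (η / 5) (by positivity)
    refine ⟨t₀ / 2, by positivity, fun t ht => ?_⟩
    have ht0 : 0 < t := ht.1
    have h2t : 2 * t ∈ Set.Ioo (0:ℝ) t₀ := ⟨by linarith, by linarith [ht.2]⟩
    obtain ⟨L₁, hL₁⟩ := hG (2 * t) h2t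
    obtain ⟨L₂, hL₂⟩ := hCGE (η / 5 * t) (by positivity)
    obtain ⟨L₃, hL₃⟩ := hEGS (η / 5) (by positivity)
    refine ⟨max L₁ (max L₂ L₃), fun L _ hL hev ψ₁ hψ₁ hψ₁1 => ?_⟩
    have hL1 : L₁ ≤ L := le_of_max_le_left hL
    have hL2 : L₂ ≤ L := (le_max_left _ _).trans (le_of_max_le_right hL)
    have hL3 : L₃ ≤ L := (le_max_right _ _).trans (le_of_max_le_right hL)
    obtain ⟨ψ₀, hψ₀1, hψ₀⟩ := exists_unit_isGroundStateInSector_hubbardTorus U L _ (hn L)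
    refine ⟨ψ₀, hψ₀, hψ₀1, ?_⟩
    have h1 := hL₁ L hL1
    have h2 := hL₂ L hL2 hev
    have h3 := hL₃ L hL3 hev ψ₀ hψ₀ hψ₀1
    have h4 := expect_le_can_gain L U t _ ψ₀ hψ₀ hψ₀1
    have h5 := quenched_chord L U t (2 * t) _ ψ₁ hψ₁ hψ₁1
    have h6 := gc_groundEnergy_le_can L U μ (2 * t) _ ⟨ψ₀, hψ₀.1, hψ₀.2.1⟩
    have hLpos : (0 : ℝ) < (L : ℝ) := Nat.cast_pos.2 (Nat.pos_of_ne_zero (NeZero.ne L))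
    have htL : 0 < t * (L : ℝ) ^ 2 := by positivity
    refine le_of_mul_le_mul_left ?_ htL
    linarith [mul_le_mul_of_nonneg_left h3 htL.le]

end Summit.HubbardSuperconductivity.HubbardSuperconductivity.Theorems.WcbcsSsbToTorusLRO

end
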